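/-
Copyright (c) 2026 the pub-hodgecm-mathlib formalisation cell (harness21).  Prover seat hodgecm-mathlib-K2E3-p12 (g8), Track B ∕ K2-LIT, h413 = `stmt-HodgeConjecture-24833`,
line `K2_E1_TraceFormulaBeta`, 5Res campaign, rung R8₂-sph «EXHAUSTION», ROAD T′ step T9′ — the REPAIRED assembler after the dealer's ruling (130) 2026-09-04T11:30:19Z («the
`K`-spherical residual spectrum is the finite-dimensional span of the characters `χ∘det`, not the line `ℂ·𝟙`»; memo `K2/K2E3-p12/g8/MEMO-R8sph-target-false-chidet…md`, ★ `K2E1ResidualCharacterVectorsU2`).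
-/
import Summits.HodgeConjecture.HodgeConjecture.Theorems.K2E1ResidualSphericalLineCMTwoOfLetters   -- ★ p859502 (K2E1-p12 g0): T9 ED. 1 (the line version), ★ T6, the 5Res currency
import Summits.HodgeConjecture.HodgeConjecture.Theorems.K2E1ResidualSphericalExpClauseCMTwo      -- ★ p859525 (K2E1-p12 g0): `homRangeSum_le_invariants_of_trivial`, ★ `sig_…_of_exp` currency
import Mathlib.Topology.Algebra.Module.FiniteDimension
import HarnessLib

/-!
# K2·E1 — `K2E1ResidualSphericalFiniteDimOfLetters` (R8₂-sph, ROAD T′, step T9′ — THE REPAIRED ASSEMBLER): `K`-FIXED RESIDUAL VECTORS LIE IN THE FINITE-DIMENSIONAL SPACE `E ⊓ ker f`,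
# AND THE (H4-b) EXPONENT CLAUSE AT THE TRIVIAL `K`-TYPE FROM A FINITE-DIMENSIONAL CONTINUOUS RESIDUAL SPAN

Track B ∕ K2-LIT, crux h413 = `stmt-HodgeConjecture-24833`, route of record `HCCMUnconditional`; cell `hodgecm-mathlib`, squad K2, ENGINE E1.  THEOREMS ONLY (no `def`, no `instance`, no
notation, no named-fact hypothesis, no `sorry`; default heartbeats); lane `--kind proof --supports stmt-HodgeConjecture-24833 --as helper` (count-neutral).
WHY ED. T9′ (ruling (130), this seat's finding 11:26Z, ★ `K2E1ResidualCharacterVectorsU2`).  ★ T9 p859502 concludes «every `K_U`-fixed residual vector is a multiple of `𝟙`» from letters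
including `hinj` («`(a, f)` injective on `E = (L²_cusp)ᗮ ⊓ Kfix`»).  For a CM field with `h(T¹_{L∕L⁺}; K_U) > 1` the unramified characters `χ∘det ≠ 𝟙` give `K_U`-fixed residual vectors
orthogonal to `𝟙`, so those letters are jointly unsatisfiable and the line is the wrong target; the TRUE statement is finite-dimensionality: `(L²_res)^{K_U} = span{[χ∘det]}`.  This file is
the repaired algebra: DROP `a`, `hinj`, the base vector `e₀`; KEEP `hf` (`f ∘ R₀ = M ∘ f` on `E`), `hM` (no eigenvectors — ★ T6∕T7); the kernel `E₀ := E ⊓ ker f` (in the application: the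
residual character span, dimension `h(T¹; K_U)`) replaces the line.
* §1 **`map_eq_bot_of_finiteDimensional_of_stable`** ∕ **`le_inf_ker_of_finiteDimensional_of_stable`** (any module, algebraically closed `𝕜`): a finite-dimensional `R`-stable `W ≤ E` has
  `f(W) = 0` (★ T6 on the `M`-stable finite-dimensional `f(W)`), i.e. `W ≤ E ⊓ ker f` — the `hbot` step of ★ p859502 §2, promoted to the head.
* §2 **`fixed_residual_mem_inf_ker_of_letters`** (every unitary representation; letters `hRW hRK hf hM`, `hfin : FiniteDimensional (E ⊓ ker f)`, `hadm`, `hdisc` — NO `a`, NO `hinj`, NO `e₀`):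
  every `K`-fixed `v ∈ Res` lies in `E ⊓ ker f` (each `Π ⊓ Kfix ≤ E ⊓ ker f` by §1 and admissibility; the `⨆` and its closure too, `E ⊓ ker f` being closed as finite-dimensional).
* §3 the `U(Φ₂)_{L∕L⁺}` instance **`residual_fixed_mem_inf_ker_cm_two_of_letters`** in ★ T9's currency (`cmResidualSubspaceR`, `cmCuspidalSubspaceR`, `rightRegular`, any `K_U`).
* §4 **`expClause_of_trivialKType_of_residualSpan`** — ED. 2 of ★ `expClause_of_trivialKType_of_sphericalLine`: the `∃ T`-clause of ★ `sig_K2E1ResidualCompactU2_of_exp` :45 at a trivial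
  `K`-type from the letter `hspan` (bytes of (130)): a FINITE-DIMENSIONAL space `S` of continuous square-integrable functions whose classes contain every `ιK(K)`-fixed residual vector and whose
  constant terms span a finite-dimensional `T` — discharged in (R-b) by `S := span{χ∘det}` (`CT_i(χ∘det) = νN(𝓕 i)·χ∘det` since `det u = 1`), `T := span{νN(𝓕 i)•χ∘det}`.
HONEST LABEL: HC_CM is proved only modulo the 7 printed citations (2 remaining named inputs: hLiu418 = `stmt-HodgeConjecture-24832`, h413 = `stmt-HodgeConjecture-24833`) until rung 0
closes; this file asserts no named fact, closes no socket and crosses no ceiling by itself; count-neutral; letters as listed (all believed payable: `hfin`∕`hspan` by (R-b), `hf`∕`hM` by T5′∕★ T6–T7,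
`hadm`∕`hdisc` as before).

## References
* [MoeglinWaldspurger1995] C. Mœglin, J.-L. Waldspurger, *Spectral Decomposition and Eisenstein Series* (1995), I.2.18, V.3.2–V.3.13.
* [Rogawski1990] J. D. Rogawski, *Automorphic Representations of Unitary Groups in Three Variables* (1990), §13.5 pp. 204–206.
* [Iwaniec2002] H. Iwaniec, *Spectral Methods of Automorphic Forms*, 2nd ed. (2002), §7 (p. 103).
* [Borel1997] A. Borel, *Automorphic Forms on SL₂(ℝ)* (1997), §§13–16.
-/

set_option autoImplicit false
-- the mandated namespace repeats `HodgeConjecture.HodgeConjecture`, as in every `Theorems/*.lean` of this sub-problem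
set_option linter.dupNamespace false

noncomputable section

open Submodule MeasureTheory NumberField
open Literature.NumberTheory.Automorphic Literature.NumberTheory.Automorphic.UnitaryGroup ContRepresentation AdelicGroupData
open Summit.HodgeConjecture.HodgeConjecture.Cruxes.H413.K2E1ProjectionCommutingMultiplicationOperators (submodule_eq_bot_of_invariant_of_forall_eigenvector_eq_zero')
open Summit.HodgeConjecture.HodgeConjecture.Cruxes.H413.K2E1CuspidalSpectrumUnitary
open Summit.HodgeConjecture.HodgeConjecture.Cruxes.H413.K2E1ResidualSphericalExpClauseCMTwo (homRangeSum_le_invariants_of_trivial)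

namespace Summit.HodgeConjecture.HodgeConjecture.Cruxes.H413.K2E1ResidualSphericalFiniteDimOfLetters

/-! ## §1 Finite-dimensional `R`-stable subspaces of `E` are killed by `f` -/

section Stable

variable {𝕜 : Type*} [Field 𝕜] [IsAlgClosed 𝕜] {H : Type*} [AddCommGroup H] [Module 𝕜 H] {F : Type*} [AddCommGroup F] [Module 𝕜 F]

/-- **`f(W) = 0` FOR EVERY FINITE-DIMENSIONAL `R`-STABLE `W ≤ E`** (algebraically closed `𝕜`): `f(W)` is a finite-dimensional `M`-stable subspace (`f ∘ R = M ∘ f` on `E ⊇ W`) on which `M` has no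
eigenvector, hence `⊥` (★ T6 `submodule_eq_bot_of_invariant_of_forall_eigenvector_eq_zero'`).  The `hbot` step of ★ p859502 §2, without `a`, `hinj`, `e₀`. [cite: Iwaniec2002, §7 (p. 103)]
[cite: MoeglinWaldspurger1995, V.3.13] -/
theorem map_eq_bot_of_finiteDimensional_of_stable (R : H →ₗ[𝕜] H) (E : Submodule 𝕜 H) (f : H →ₗ[𝕜] F) (M : F →ₗ[𝕜] F)
    (hf : ∀ v ∈ E, f (R v) = M (f v)) (hM : ∀ (c : 𝕜) (w : F), M w = c • w → w = 0)
    (W : Submodule 𝕜 H) [FiniteDimensional 𝕜 W] (hWE : W ≤ E) (hWR : ∀ w ∈ W, R w ∈ W) : W.map f = ⊥ := by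
  have hstable : ∀ y ∈ W.map f, M y ∈ W.map f := by
    rintro _ ⟨w, hw, rfl⟩
    exact ⟨R w, hWR w hw, hf w (hWE hw)⟩
  exact submodule_eq_bot_of_invariant_of_forall_eigenvector_eq_zero' M (W.map f) hstable fun c y h => hM c y h

/-- **EVERY FINITE-DIMENSIONAL `R`-STABLE `W ≤ E` LIES IN `E ⊓ ker f`** (the repaired T9 target: a finite-dimensional KERNEL in place of the line `𝕜 ∙ e₀`). [cite: Iwaniec2002, §7 (p. 103)]
[cite: MoeglinWaldspurger1995, V.3.13] -/
theorem le_inf_ker_of_finiteDimensional_of_stable (R : H →ₗ[𝕜] H) (E : Submodule 𝕜 H) (f : H →ₗ[𝕜] F) (M : F →ₗ[𝕜] F)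
    (hf : ∀ v ∈ E, f (R v) = M (f v)) (hM : ∀ (c : 𝕜) (w : F), M w = c • w → w = 0)
    (W : Submodule 𝕜 H) [FiniteDimensional 𝕜 W] (hWE : W ≤ E) (hWR : ∀ w ∈ W, R w ∈ W) : W ≤ E ⊓ LinearMap.ker f := by
  have hbot := map_eq_bot_of_finiteDimensional_of_stable R E f M hf hM W hWE hWR
  intro w hw
  refine ⟨hWE hw, LinearMap.mem_ker.2 ?_⟩
  have : f w ∈ W.map f := ⟨w, hw, rfl⟩
  rw [hbot] at this
  exact (mem_bot 𝕜).1 this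

end Stable

/-! ## §2 The representation-theoretic assembly ON LETTERS: `K`-fixed vectors of `Res` lie in the finite-dimensional `E ⊓ ker f` -/

section Rep

variable {G : Type*} [Group G] {V : Type*} [NormedAddCommGroup V] [InnerProductSpace ℂ V] [CompleteSpace V] {π : ContRepresentation ℂ G V}

/-- **T9′ ON LETTERS, EVERY UNITARY REPRESENTATION** — the repaired twin of ★ `fixed_residual_mem_span_of_letters`: `π` unitary on a Hilbert space, closed invariant `C, Res` with `Res ⟂ C`, `K ⊆ G`
with its fixed-vector submodule `Kfix` (pinned by `hKfix`), `R₀` preserving every closed invariant `W ≤ Res` (`hRW`) and `K`-fixedness (`hRK`), Plancherel data `(f, M)` on `E := Cᗮ ⊓ Kfix` —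
`hf` intertwining, `hM` no eigenvectors —, `hfin : E ⊓ ker f` FINITE-DIMENSIONAL (the residual character span), ADMISSIBILITY `hadm`, DISCRETE CLOSURE `hdisc`: **every `K`-fixed `v ∈ Res` lies
in `E ⊓ ker f`** — each `Π ⊓ Kfix ≤ E ⊓ ker f` by §1, the `⨆` and its closure too (a finite-dimensional subspace is closed).  NO `a`, NO `hinj`, NO base vector.
[cite: MoeglinWaldspurger1995, V.3.13] [cite: Iwaniec2002, §7 (p. 103)] [cite: Borel1997, §§13–16] -/
theorem fixed_residual_mem_inf_ker_of_letters (hu : π.IsUnitary) (C Res : ClosedSubrep π) (hResC : ∀ v ∈ Res, v ∈ C.orthogonal hu)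
    {S : Type*} [SetLike S G] (K : S)
    (Kfix : Submodule ℂ V) (hKfix : ∀ v : V, v ∈ Kfix ↔ ∀ k ∈ K, π k v = v)
    {F : Type*} [AddCommGroup F] [Module ℂ F]
    (R₀ : V →ₗ[ℂ] V) (f : V →ₗ[ℂ] F) (M : F →ₗ[ℂ] F)
    (hRW : ∀ W : ClosedSubrep π, W ≤ Res → ∀ v ∈ W, R₀ v ∈ W)
    (hRK : ∀ v : V, (∀ k ∈ K, π k v = v) → ∀ k ∈ K, π k (R₀ v) = R₀ v)
    (hf : ∀ v ∈ C.orthogonal hu, (∀ k ∈ K, π k v = v) → f (R₀ v) = M (f v))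
    (hM : ∀ (c : ℂ) (w : F), M w = c • w → w = 0)
    (hfin : FiniteDimensional ℂ ↥(((C.orthogonal hu).toSubmodule ⊓ Kfix) ⊓ LinearMap.ker f))
    (hadm : ∀ W : ClosedSubrep π, W ≤ Res → W.toContRep.IsTopIrreducible → FiniteDimensional ℂ ↥(W.toSubmodule ⊓ Kfix))
    (hdisc : ∀ v ∈ Res, (∀ k ∈ K, π k v = v) →
      v ∈ (⨆ W ∈ {W : ClosedSubrep π | W ≤ Res ∧ W.toContRep.IsTopIrreducible}, W.toSubmodule ⊓ Kfix).topologicalClosure)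
    {v : V} (hv : v ∈ Res) (hvK : ∀ k ∈ K, π k v = v) : v ∈ ((C.orthogonal hu).toSubmodule ⊓ Kfix) ⊓ LinearMap.ker f := by
  set E : Submodule ℂ V := (C.orthogonal hu).toSubmodule ⊓ Kfix with hE
  have hfE : ∀ w ∈ E, f (R₀ w) = M (f w) := fun w hw => hf w hw.1 ((hKfix w).1 hw.2)
  -- each irreducible `W ≤ Res`: `W ⊓ Kfix ≤ E ⊓ ker f`
  have hW : ∀ W : ClosedSubrep π, W ≤ Res → W.toContRep.IsTopIrreducible → W.toSubmodule ⊓ Kfix ≤ E ⊓ LinearMap.ker f := by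
    intro W hWres hWirr
    haveI := hadm W hWres hWirr
    refine le_inf_ker_of_finiteDimensional_of_stable R₀ E f M hfE hM (W.toSubmodule ⊓ Kfix) ?_ ?_
    · rintro w ⟨hwW, hwK⟩
      exact ⟨hResC w (hWres hwW), hwK⟩
    · rintro w ⟨hwW, hwK⟩
      exact ⟨hRW W hWres w hwW, (hKfix _).2 (hRK w ((hKfix w).1 hwK))⟩
  have hsup : (⨆ W ∈ {W : ClosedSubrep π | W ≤ Res ∧ W.toContRep.IsTopIrreducible}, W.toSubmodule ⊓ Kfix) ≤ E ⊓ LinearMap.ker f :=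
    iSup₂_le fun W hWS => hW W hWS.1 hWS.2
  haveI := hfin
  have hcl : (⨆ W ∈ {W : ClosedSubrep π | W ≤ Res ∧ W.toContRep.IsTopIrreducible}, W.toSubmodule ⊓ Kfix).topologicalClosure ≤ E ⊓ LinearMap.ker f :=
    Submodule.topologicalClosure_minimal _ hsup (Submodule.closed_of_finiteDimensional _)
  exact hcl (hdisc v hv hvK)

end Rep

/-! ## §3 `U(Φ₂)(L⁺)∖U(Φ₂)(𝔸_{L⁺})`: the `K_U`-FIXED RESIDUAL VECTORS LIE IN THE FINITE-DIMENSIONAL `E ⊓ ker f`, ON THE LETTERS (ruling (130)'s road of record) -/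

section CM

variable (L : Type) [Field L] [NumberField L] [IsCMField L]
  (μ : Measure (UnitaryGroup.cmDatum L 2 (Matrix.of fun i j : Fin 2 => if i.val + j.val + 1 = 2 then (1 : L) else 0)).automorphicQuotient)
  [(UnitaryGroup.cmDatum L 2 (Matrix.of fun i j : Fin 2 => if i.val + j.val + 1 = 2 then (1 : L) else 0)).IsAutomorphicMeasure μ]

/-- **R8₂-sph EXHAUSTION, REPAIRED TARGET, ON THE LETTERS**: for the right regular representation of `U(Φ₂)(𝔸_{L⁺})` on `L²(U(Φ₂)(L⁺)∖U(Φ₂)(𝔸_{L⁺}), μ)`, ANY `K_U ≤ G(𝔸)` with its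
fixed-vector submodule `Kfix`, Plancherel data `(f, M)` on `E := (L²_cusp)ᗮ ⊓ Kfix` (letters `hf`, `hM`), `hfin : E ⊓ ker f` finite-dimensional, `hRW`, `hRK`, `hadm`, `hdisc` as in ★ T9:
**every `K_U`-fixed `v ∈ cmResidualSubspaceR L 2 μ` lies in `E ⊓ ker f`** — so `(L²_res)^{K_U}` is finite-dimensional (what ★ `sig_K2E1ResidualCompactU2` needs at the spherical level); by ★
`K2E1ResidualCharacterVectorsU2` the span of the unramified character vectors `[χ∘det]` is INSIDE `(L²_res)^{K_U}`, and (R-b) identifies `E ⊓ ker f` with it. [cite: MoeglinWaldspurger1995, V.3.13]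
[cite: Iwaniec2002, §7 (p. 103)] [cite: Rogawski1990, §13.5] -/
theorem residual_fixed_mem_inf_ker_cm_two_of_letters
    (K_U : Subgroup (UnitaryGroup.cmDatum L 2 (Matrix.of fun i j : Fin 2 => if i.val + j.val + 1 = 2 then (1 : L) else 0)).Adelic)
    (Kfix : Submodule ℂ ((UnitaryGroup.cmDatum L 2 (Matrix.of fun i j : Fin 2 => if i.val + j.val + 1 = 2 then (1 : L) else 0)).L2 μ))
    (hKfix : ∀ v, v ∈ Kfix ↔ ∀ k ∈ K_U, (UnitaryGroup.cmDatum L 2 (Matrix.of fun i j : Fin 2 => if i.val + j.val + 1 = 2 then (1 : L) else 0)).rightRegular μ k v = v)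
    {F : Type*} [AddCommGroup F] [Module ℂ F]
    (R₀ : (UnitaryGroup.cmDatum L 2 (Matrix.of fun i j : Fin 2 => if i.val + j.val + 1 = 2 then (1 : L) else 0)).L2 μ →ₗ[ℂ]
      (UnitaryGroup.cmDatum L 2 (Matrix.of fun i j : Fin 2 => if i.val + j.val + 1 = 2 then (1 : L) else 0)).L2 μ)
    (f : (UnitaryGroup.cmDatum L 2 (Matrix.of fun i j : Fin 2 => if i.val + j.val + 1 = 2 then (1 : L) else 0)).L2 μ →ₗ[ℂ] F) (M : F →ₗ[ℂ] F)
    (hRW : ∀ W : ClosedSubrep ((UnitaryGroup.cmDatum L 2 (Matrix.of fun i j : Fin 2 => if i.val + j.val + 1 = 2 then (1 : L) else 0)).rightRegular μ),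
      W ≤ cmResidualSubspaceR L 2 μ → ∀ v ∈ W, R₀ v ∈ W)
    (hRK : ∀ v, (∀ k ∈ K_U, (UnitaryGroup.cmDatum L 2 (Matrix.of fun i j : Fin 2 => if i.val + j.val + 1 = 2 then (1 : L) else 0)).rightRegular μ k v = v) →
      ∀ k ∈ K_U, (UnitaryGroup.cmDatum L 2 (Matrix.of fun i j : Fin 2 => if i.val + j.val + 1 = 2 then (1 : L) else 0)).rightRegular μ k (R₀ v) = R₀ v)
    (hf : ∀ v ∈ (cmCuspidalSubspaceR L 2 μ).orthogonal ((UnitaryGroup.cmDatum L 2 (Matrix.of fun i j : Fin 2 => if i.val + j.val + 1 = 2 then (1 : L) else 0)).isUnitary_rightRegular μ),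
      (∀ k ∈ K_U, (UnitaryGroup.cmDatum L 2 (Matrix.of fun i j : Fin 2 => if i.val + j.val + 1 = 2 then (1 : L) else 0)).rightRegular μ k v = v) → f (R₀ v) = M (f v))
    (hM : ∀ (c : ℂ) (w : F), M w = c • w → w = 0)
    (hfin : FiniteDimensional ℂ ↥((((cmCuspidalSubspaceR L 2 μ).orthogonal ((UnitaryGroup.cmDatum L 2 (Matrix.of fun i j : Fin 2 => if i.val + j.val + 1 = 2 then (1 : L) else 0)).isUnitary_rightRegular μ)).toSubmodule ⊓ Kfix) ⊓ LinearMap.ker f))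
    (hadm : ∀ W : ClosedSubrep ((UnitaryGroup.cmDatum L 2 (Matrix.of fun i j : Fin 2 => if i.val + j.val + 1 = 2 then (1 : L) else 0)).rightRegular μ),
      W ≤ cmResidualSubspaceR L 2 μ → W.toContRep.IsTopIrreducible → FiniteDimensional ℂ ↥(W.toSubmodule ⊓ Kfix))
    (hdisc : ∀ v ∈ cmResidualSubspaceR L 2 μ, (∀ k ∈ K_U, (UnitaryGroup.cmDatum L 2 (Matrix.of fun i j : Fin 2 => if i.val + j.val + 1 = 2 then (1 : L) else 0)).rightRegular μ k v = v) →
      v ∈ (⨆ W ∈ {W : ClosedSubrep ((UnitaryGroup.cmDatum L 2 (Matrix.of fun i j : Fin 2 => if i.val + j.val + 1 = 2 then (1 : L) else 0)).rightRegular μ) |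
        W ≤ cmResidualSubspaceR L 2 μ ∧ W.toContRep.IsTopIrreducible}, W.toSubmodule ⊓ Kfix).topologicalClosure) :
    ∀ v ∈ (cmResidualSubspaceR L 2 μ).toSubmodule,
      (∀ k ∈ K_U, (UnitaryGroup.cmDatum L 2 (Matrix.of fun i j : Fin 2 => if i.val + j.val + 1 = 2 then (1 : L) else 0)).rightRegular μ k v = v) →
        v ∈ (((cmCuspidalSubspaceR L 2 μ).orthogonal ((UnitaryGroup.cmDatum L 2 (Matrix.of fun i j : Fin 2 => if i.val + j.val + 1 = 2 then (1 : L) else 0)).isUnitary_rightRegular μ)).toSubmodule ⊓ Kfix) ⊓ LinearMap.ker f :=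
  fun _ hv hvK => fixed_residual_mem_inf_ker_of_letters (π := (UnitaryGroup.cmDatum L 2 (Matrix.of fun i j : Fin 2 => if i.val + j.val + 1 = 2 then (1 : L) else 0)).rightRegular μ)
    ((UnitaryGroup.cmDatum L 2 (Matrix.of fun i j : Fin 2 => if i.val + j.val + 1 = 2 then (1 : L) else 0)).isUnitary_rightRegular μ)
    (cmCuspidalSubspaceR L 2 μ) (cmResidualSubspaceR L 2 μ)
    (fun _ hw => (show (cmResidualSubspaceR L 2 μ).toSubmodule ≤ (cmCuspidalSubspaceR L 2 μ).toSubmoduleᗮ from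
      (isOrtho_cuspidalSubspace_residualSubspace _ μ (cmParabolicDataR L 2)).symm) hw)
    K_U Kfix hKfix R₀ f M hRW hRK hf hM hfin hadm hdisc hv hvK

/-! ## §4 The (H4-b) exponent clause at a trivial `K`-type from a FINITE-DIMENSIONAL continuous residual span (ED. 2 of ★ `expClause_of_trivialKType_of_sphericalLine`) -/

/-- **(H4-b) AT THE TRIVIAL `K`-TYPE FROM A FINITE-DIMENSIONAL CONTINUOUS RESIDUAL SPAN** (ruling (130) bytes).  Data as in ★ `sig_K2E1ResidualCompactU2_of_exp` :45 (`ιK : K →* G(𝔸)`, Haar data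
`νN i`, `𝓕 i` on the radicals of ★ `cmParabolicData L 2`, a `K`-stable `E ≤ cmResidualSubspace L 2 μ` on which `K` acts trivially).  LETTER `hspan`: a finite-dimensional `S ≤ (X → ℂ)` of
CONTINUOUS square-integrable functions such that every `ιK(K)`-fixed residual vector is the class of some `ψ ∈ S`, and the constant-term functions of the members of `S` lie in one
finite-dimensional `T` — discharged in (R-b) by `S := span{χ∘det : χ unramified}` (`CT_i(χ∘det) = νN(𝓕 i)·χ∘det`, `det u = 1`).  CONCLUSION = the `∃ T`-clause of :45 VERBATIM for this `E`:
every `w` of the isotypic part is `K`-fixed (★ §1 of the ED. 1 file), hence the class of some `ψ₀ ∈ S`; a continuous representative `ψ` of the same class IS `ψ₀` (an automorphic `μ` charges open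
sets), so its constant terms are those of `ψ₀`, inside `T`. [cite: MoeglinWaldspurger1995, I.2.18 and V.3.13] [cite: Rogawski1990, §13.5] -/
theorem expClause_of_trivialKType_of_residualSpan
    {K : Type} [Group K] (ιK : K →* (UnitaryGroup.cmDatum L 2 (Matrix.of fun i j : Fin 2 => if i.val + j.val + 1 = 2 then (1 : L) else 0)).Adelic)
    [∀ i, MeasurableSpace ((cmParabolicData L 2).radical i)]
    (νN : ∀ i, Measure ((cmParabolicData L 2).radical i)) (𝓕 : ∀ i, Set ((cmParabolicData L 2).radical i))
    (hspan : ∃ S : Submodule ℂ ((UnitaryGroup.cmDatum L 2 (Matrix.of fun i j : Fin 2 => if i.val + j.val + 1 = 2 then (1 : L) else 0)).automorphicQuotient → ℂ),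
      FiniteDimensional ℂ S ∧ (∀ ψ ∈ S, Continuous ψ ∧ MemLp ψ 2 μ) ∧
      (∀ v ∈ (cmResidualSubspace L 2 μ).toSubmodule,
        (∀ k : K, (UnitaryGroup.cmDatum L 2 (Matrix.of fun i j : Fin 2 => if i.val + j.val + 1 = 2 then (1 : L) else 0)).rightRegular μ (ιK k) v = v) →
          ∃ ψ ∈ S, ∃ hψ : MemLp ψ 2 μ, hψ.toLp ψ = v) ∧
      ∃ T : Submodule ℂ ((UnitaryGroup.cmDatum L 2 (Matrix.of fun i j : Fin 2 => if i.val + j.val + 1 = 2 then (1 : L) else 0)).Adelic → ℂ), FiniteDimensional ℂ T ∧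
        ∀ ψ ∈ S, ∀ i, (fun x => ∫ u in 𝓕 i, ψ ((UnitaryGroup.cmDatum L 2 (Matrix.of fun i j : Fin 2 => if i.val + j.val + 1 = 2 then (1 : L) else 0)).toAutomorphicQuotient
          (x * (u : (UnitaryGroup.cmDatum L 2 (Matrix.of fun i j : Fin 2 => if i.val + j.val + 1 = 2 then (1 : L) else 0)).Adelic)⁻¹)) ∂(νN i)) ∈ T)
    (E : Submodule ℂ (cmResidualSubspace L 2 μ).toSubmodule) (hE : ∀ k, ∀ x ∈ E, ((cmResidualSubspace L 2 μ).toContRep.restrict ιK) k x ∈ E)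
    (htriv : ∀ k, ∀ x ∈ E, ((cmResidualSubspace L 2 μ).toContRep.restrict ιK) k x = x) :
    ∃ T : Submodule ℂ ((UnitaryGroup.cmDatum L 2 (Matrix.of fun i j : Fin 2 => if i.val + j.val + 1 = 2 then (1 : L) else 0)).Adelic → ℂ), FiniteDimensional ℂ T ∧
      ∀ w ∈ Representation.homRangeSum ((cmResidualSubspace L 2 μ).toContRep.restrict ιK).toRepresentation
          (((cmResidualSubspace L 2 μ).toContRep.restrict ιK).subRep E hE),
        ∀ ψ : (UnitaryGroup.cmDatum L 2 (Matrix.of fun i j : Fin 2 => if i.val + j.val + 1 = 2 then (1 : L) else 0)).automorphicQuotient → ℂ, Continuous ψ →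
          ∀ hψ : MemLp ψ 2 μ, hψ.toLp ψ = ((w : (cmResidualSubspace L 2 μ).toSubmodule) :
              (UnitaryGroup.cmDatum L 2 (Matrix.of fun i j : Fin 2 => if i.val + j.val + 1 = 2 then (1 : L) else 0)).L2 μ) →
            ∀ i, (fun x => ∫ u in 𝓕 i, ψ ((UnitaryGroup.cmDatum L 2 (Matrix.of fun i j : Fin 2 => if i.val + j.val + 1 = 2 then (1 : L) else 0)).toAutomorphicQuotient
              (x * (u : (UnitaryGroup.cmDatum L 2 (Matrix.of fun i j : Fin 2 => if i.val + j.val + 1 = 2 then (1 : L) else 0)).Adelic)⁻¹)) ∂(νN i)) ∈ T := by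
  obtain ⟨S, _, hSc, hSres, T, hTfin, hST⟩ := hspan
  refine ⟨T, hTfin, fun w hw ψ hψc hψ hψw i => ?_⟩
  -- the `E`-isotypic part is `K`-fixed (★ §1 of ED. 1; `K` acts trivially on `E`)
  have hτ : ∀ (k : K) (e : E), (((cmResidualSubspace L 2 μ).toContRep.restrict ιK).subRep E hE) k e = e := fun k e =>
    Subtype.ext (htriv k e e.2)
  have hwinv := homRangeSum_le_invariants_of_trivial _ _ hτ hw
  have hwK : ∀ k : K, (UnitaryGroup.cmDatum L 2 (Matrix.of fun i j : Fin 2 => if i.val + j.val + 1 = 2 then (1 : L) else 0)).rightRegular μ (ιK k)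
      ((w : (cmResidualSubspace L 2 μ).toSubmodule) : (UnitaryGroup.cmDatum L 2 (Matrix.of fun i j : Fin 2 => if i.val + j.val + 1 = 2 then (1 : L) else 0)).L2 μ) =
        (w : (cmResidualSubspace L 2 μ).toSubmodule) := fun k =>
    congrArg Subtype.val ((Representation.mem_invariants _ _).1 hwinv k)
  -- hence `w = [ψ₀]` for some `ψ₀ ∈ S`
  obtain ⟨ψ₀, hψ₀S, hψ₀, hψ₀w⟩ := hSres _ (w : (cmResidualSubspace L 2 μ).toSubmodule).2 hwK
  -- the continuous representative `ψ` of the same class IS `ψ₀`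
  have hψae : ψ =ᵐ[μ] ψ₀ := by
    have h1 := hψ.coeFn_toLp
    have h2 := hψ₀.coeFn_toLp
    rw [hψw, ← hψ₀w] at h1
    exact h1.symm.trans h2
  have hψeq : ψ = ψ₀ := (Continuous.ae_eq_iff_eq μ hψc (hSc ψ₀ hψ₀S).1).1 hψae
  rw [hψeq]
  exact hST ψ₀ hψ₀S i

end CM

end Summit.HodgeConjecture.HodgeConjecture.Cruxes.H413.K2E1ResidualSphericalFiniteDimOfLetters

end
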